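import Literature.Topology.FourManifolds.MorseBridgingPairProof
import Literature.Topology.FourManifolds.DisjointSpheresSlab
import Literature.Topology.FourManifolds.HCobordismFirstCancellationProofs
import Literature.Topology.FourManifolds.HCobordismIndexZeroOneProofs
import Literature.Topology.FourManifolds.HCobordismTheoremProofs
import HarnessLib

/-!
# spc4.S24 (b), nice Morse functions on closed manifolds: what
# `Literature.Topology.FourManifolds.exists_isMorse_isSelfIndexing` now rests on

Topic `Literature/Topology/FourManifolds` (fact seat
`provefact-Literature.Topology.FourManifolds.exists_isMorse_isSelfIndexing`; proofs file next to
`SPC4Handles.lean`, form (b)).  The named fact `exists_isMorse_isSelfIndexing n` — every closed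
connected smooth `n`-manifold carries a self-indexing Morse function with exactly one critical
point of index `0` and one of index `n` (Smale 1961; Milnor, *Lectures on the h-cobordism
theorem* (1965), Thm. 4.8 and §8; Matsumoto, *An introduction to Morse theory* (2002),
Thm. 3.35) — is assembled in the tree from three triad/closed-manifold facts
(`exists_isMorse_isSelfIndexing_of_triad_facts`, `MorseBridgingPair.lean`): Milnor's Thm. 4.8
for triads, the bridging `1`-handle of a closed connected manifold, and the cancellation of
one index-`0`/`1` pair on a triad.  With the discharges now in the tree —

* Thm. 4.8: `Cobordism.Milnor1965_finalRearrangement_holds` (`DisjointSpheresSlab.lean`, from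
  Thm. 4.4 on a slab and Thms. 4.1–4.2 on a slab),
* the bridging pair: `Matsumoto2001_exists_inter_leftHandSphere_eq_singleton_holds`
  (`MorseBridgingPairProof.lean`),
* the cancellation step from Thm. 4.8 and Thm. 5.4 on a slab:
  `Cobordism.Milnor1965_cancel_pair_index_zero_of_facts` (`HCobordismIndexZeroOneProofs.lean`),
* Thm. 5.4 on a slab from Assertion 6 of its proof, and Assertion 6 from the chart `ḡ`:
  `Cobordism.Milnor1965_firstCancellation_slab_of_preliminaryHypothesis`,
  `Cobordism.Milnor1965_firstCancellation_slab_of_modelChart`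
  (`HCobordismFirstCancellationProofs.lean`; Assertions 1–5 and the rescaling step are
  discharged there) —

the target follows from **one** printed ingredient still vendored as a named fact: the
First Cancellation Theorem 5.4 on a sub-triad (`Cobordism.Milnor1965_firstCancellation_slab`),
indeed from the general case of Assertion 6 of its proof alone
(`Cobordism.Milnor1965_cancellation_modelChart`, PDF pp. 30–32 with Thm. 5.6, Lemmas 5.7, 5.9
and Lemma 4.7).  This file records the two reductions (**proved**):
`exists_isMorse_isSelfIndexing_of_firstCancellation_slab`,
`exists_isMorse_isSelfIndexing_of_modelChart`; and, that last leaf being discharged in the tree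
(`Cobordism.Milnor1965_cancellation_modelChart_holds`, `HCobordismTheoremProofs.lean`, from
Milnor's Thm. 5.6 through `Cobordism.Milnor1965_cancellation_levelDeformation_holds`), the
**discharge** of the named fact itself: `exists_isMorse_isSelfIndexing_holds`.

## References

* J. Milnor, *Lectures on the h-cobordism theorem*, notes by L. Siebenmann and J. Sondow,
  Princeton Mathematical Notes (1965): Thm. 4.8 (PDF p. 25), Thm. 5.4 and its proof
  (PDF pp. 27–36), Thm. 8.1 and its proof for Index 0 (PDF p. 54).  Held:
  `lit read book:milnornd-lectures-h-cobordism-theorem`. [MilnorHCobordism1965]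
* Y. Matsumoto, *An introduction to Morse theory*, Transl. Math. Monogr. 208, AMS (2002),
  Thm. 3.35 (PDF pp. 119–120). [Matsumoto2001]
-/

noncomputable section

namespace Literature.Topology.FourManifolds

universe u

/-- **`exists_isMorse_isSelfIndexing n` from the First Cancellation Theorem 5.4 on a
sub-triad alone** (`Cobordism.Milnor1965_firstCancellation_slab`): Thm. 4.8
(`Cobordism.Milnor1965_finalRearrangement_holds`), the bridging pair
(`Matsumoto2001_exists_inter_leftHandSphere_eq_singleton_holds`) and the rest of the
cancellation step (`Cobordism.Milnor1965_cancel_pair_index_zero_of_facts`) being proved.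
[cite: MilnorHCobordism1965, Thm. 4.8 (PDF p. 25), Thm. 5.4 (PDF p. 27), proof of Thm. 8.1 Index 0 (PDF p. 54)] [cite: Matsumoto2001, Thm. 3.35] -/
theorem exists_isMorse_isSelfIndexing_of_firstCancellation_slab
    (h54 : Cobordism.Milnor1965_firstCancellation_slab.{u}) (n : ℕ) :
    FourManifolds.exists_isMorse_isSelfIndexing.{u} n :=
  exists_isMorse_isSelfIndexing_of_rearrangement_of_cancel
    Cobordism.Milnor1965_finalRearrangement_holds
    (Cobordism.Milnor1965_cancel_pair_index_zero_of_facts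
      Cobordism.Milnor1965_finalRearrangement_holds h54) n

/-- **`exists_isMorse_isSelfIndexing n` from the general case of Assertion 6 of the proof of
Thm. 5.4 alone** (`Cobordism.Milnor1965_cancellation_modelChart`: the chart `ḡ` carrying
the model field to `kξ` near the trajectory `T`, PDF pp. 30–32), by
`Cobordism.Milnor1965_firstCancellation_slab_of_modelChart`.
[cite: MilnorHCobordism1965, proof of Thm. 5.4, Assertion 6 (PDF pp. 30–32)] [cite: Matsumoto2001, Thm. 3.35] -/
theorem exists_isMorse_isSelfIndexing_of_modelChart
    (hE : Cobordism.Milnor1965_cancellation_modelChart.{u}) (n : ℕ) :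
    FourManifolds.exists_isMorse_isSelfIndexing.{u} n :=
  exists_isMorse_isSelfIndexing_of_firstCancellation_slab
    (Cobordism.Milnor1965_firstCancellation_slab_of_modelChart hE) n

/-- **Discharge of `Literature.Topology.FourManifolds.exists_isMorse_isSelfIndexing`** (Smale 1961,
Thm. A; Milnor 1965, Thm. 4.8 with §8; Matsumoto 2002, Thm. 3.35): *every closed connected
smooth `n`-manifold carries a self-indexing Morse function with exactly one critical point of
index `0` and exactly one of index `n`* — `exists_isMorse_isSelfIndexing_of_modelChart` fed
with the tree's theorem `Cobordism.Milnor1965_cancellation_modelChart_holds` (the chart `ḡ` of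
Assertion 6 in the proof of Milnor's First Cancellation Theorem 5.4, PDF pp. 30–32), so that
every printed ingredient of the assembly `exists_isMorse_isSelfIndexing_of_triad_facts` is now a
theorem of the tree.
[cite: MilnorHCobordism1965, Thm. 4.8 (PDF p. 25) and §8, proof of Thm. 8.1 Index 0 (PDF p. 54)] [cite: Matsumoto2001, Thm. 3.35] -/
theorem exists_isMorse_isSelfIndexing_holds :
    ∀ n : ℕ, FourManifolds.exists_isMorse_isSelfIndexing.{u} n :=
  exists_isMorse_isSelfIndexing_of_modelChart Cobordism.Milnor1965_cancellation_modelChart_holds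

end Literature.Topology.FourManifolds
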